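import Summits.QuantumFields.YangMills.Theorems.FluctuationComparisonRegPrIntLS2BetaSupTowerOfLiftLadderNested
import Summits.QuantumFields.YangMills.Theorems.FluctuationComparisonRegPrIntLS2BetaReadNesting
import Summits.QuantumFields.YangMills.Theorems.UnitScaleTiltFluctuationComparisonRegPrGlobalSlackKernelLegAnchorCoherent
import Literature.MathematicalPhysics.QuantumFieldTheory.Balaban1983to89.B15Prop1DatumSmall7AtZSequence
import HarnessLib

/-!
# S2β · (c₁ KNIT, LETTER M-3b) THE T³ TRANSPORT OF READ′: a bond `ℓ′` of ✓FILE 3′'s thickened read set `READ′_t(B)` (level `0` of the family member `F.P (J+t+1)`) is, after the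
# level identification `siteShift` into the finest member `F.P K` (internal level `n`, `J + (t+1) + n = K`), a member of (M-3)'s read set `read n B` with `θ = 2` and endpoint cells
# `ends B = {(bondShift B).src, (bondShift B).tgt}` at internal level `m = n + (t+1) = K − J`

Cell `ym3-torus` (YM ladder rung R3 = continuum `SU(2)` Yang–Mills on the three-torus at fixed lattice data — a RUNG: NOT d = 4, NOT infinite volume, NOT a mass gap,
NOT Clay).  Width seat `ym3-torus-px13` (gen 27); crux `stmt-QuantumFields-20520`, LINE g18-1 S2β, pairing lane; the bridge between ✓p831146 `…S2BetaSupTowerOfLiftLadderNested`'s READ′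
text (one `Params` PER LEVEL, `bondShift` ∕ `blockIter (t+1)`) and the ONE-`Params` read sets of `…S2BetaTorusCellClasses` (M-3) that feed ✓p831065 `dock_of_kernel`.
`--kind proof --supports stmt-QuantumFields-20520 --as helper`, count-neutral, DEFINITION-FREE.

WHAT IS PROVED (sorry-free).  ★`siteShift_blockIter_eq_blockOfIter` (`siteShift (blockIter s z) = blockOfIter s (siteShift z)`: the iterated block map commutes with the level identification,
induction over lit ✓`siteShift_blockOf`), ★★★`read'_transport` — for `J + (t+1) + n = K`, `n + (t+1) = m`, `B : PBond (F.P J) 0`, `ℓ′ : PBond (F.P (J+(t+1))) 0` satisfying READ′ (FILE 3′'s clause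
VERBATIM): `embIter n (siteShift _ ℓ′.src) ∈ read n B` (M-3's set-former VERBATIM with `θ = 2`, `ends B = {(bondShift _ B).src, (bondShift _ B).tgt}`), witness `z₀ = embIter n (siteShift _ z)`
(✓`rel_siteShift`, lit ✓`blockIter_embIter`, ✓`blockIter_add_embIter`, `bondShift_src∕tgt`, `siteShift_siteShift`); ★★`read'_transport_of_rel_le` — the same for every
`Y` with `|rel ℓ′.src Y| ≤ D`, landing in the read set of thickness `θ = 2 + D` (px16 g23's request: the NC-row's ladder plaquettes); ★`card_filter_mem_ends_le` — the endpoint multiplicity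
`η = 6` (= `2d`) for (M-3)'s `card_filter_mem_top_le`: a site of internal level `m` is `src` or `tgt` of at most six transported coarsest bonds.

HONEST.  Index transport only; nothing of Bałaban's asserted; (K0)–(K5), the dock's weights, (★), (SCT′-c)₁₂₃, (LIFT-LAD′), (TOP-LAD′), (ST′), (ST), LOC, GAP♯∘ (`stub_uniformFibreGapOrbit`, registry
3732b7df UNTOUCHED, 0∕5), the five REGISTERED stubs, S2β, crux 20520, 19936, 19200, `YM3TorusSU2` — NOT proved; rung R3 = SU(2) YM₃ on T³ — NOT d = 4, NOT infinite volume, NOT a mass gap,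
NOT Clay; the Yang–Mills mass gap is NOT proved.  Axioms standard.

References: [Balaban1987RG1] CMP **109** (1987) (0.1)–(0.4) pp.251–253; [Balaban1985Averaging] CMP **98** (1985) Prop. 4 (128)–(135) pp.37–38.
-/

set_option autoImplicit false

open Finset

namespace Summit.QuantumFields.YangMills.Theorems.FluctuationComparisonRegPrIntLS2BetaTorusReadTransport

open Literature.MathematicalPhysics.QuantumFieldTheory.Balaban1983to89
open Literature.MathematicalPhysics.QuantumFieldTheory.Balaban1983to89.T3ContinuumYM3Torus
open Literature.MathematicalPhysics.QuantumFieldTheory.Balaban1983to89.T3LevelShift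
open Literature.MathematicalPhysics.QuantumFieldTheory.Balaban1983to89.T4Continuum
open Literature.MathematicalPhysics.QuantumFieldTheory.Balaban1983to89.B14.Eq22Determines (blockIter blockIter_zero blockIter_succ)
open Literature.MathematicalPhysics.QuantumFieldTheory.Balaban1983to89.B15DeterminingSets (embIter)
open Literature.MathematicalPhysics.QuantumFieldTheory.Balaban1983to89.B15Eq177GaugeInvariance (blockIter_embIter)
open Literature.MathematicalPhysics.QuantumFieldTheory.Balaban1983to89.B15Prop1DatumSmall7AtZSequence (blockIter_add_embIter)
open Literature.MathematicalPhysics.QuantumFieldTheory.Balaban1983to89.B7SectAStatements (blockOfIter blockOfIter_zero blockOfIter_succ)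
open Literature.MathematicalPhysics.QuantumFieldTheory.Balaban1983to89.B10Eq27TorusAxialLog (rel)
open Summit.QuantumFields.YangMills.Theorems.GlobalSlackKernelLeg (rel_siteShift)
open Summit.QuantumFields.YangMills.Theorems.FluctuationComparisonRegPrIntLS2BetaReadNesting (natAbs_rel_le_add)

variable {F : T3Family}

/-- ★ **THE ITERATED BLOCK MAP COMMUTES WITH THE LEVEL IDENTIFICATION**: `siteShift (blockIter s z) = blockOfIter s (siteShift z)` for `z` at internal level `0` of the member `F.P K₁`,
transported to internal level `n` of the member `F.P K₂` (`K₁ + n = K₂`), the two level pairs matched (induction over lit ✓`siteShift_blockOf`). [cite: Balaban1987RG1, (0.3)-(0.4) p.252-253] -/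
theorem siteShift_blockIter_eq_blockOfIter {K₁ K₂ n : ℕ} (hK : K₁ + n = K₂) (z : Site (F.P K₁) 0) :
    ∀ s : ℕ, siteShift (F.sitesPerDir_eq (m := F.m) (K := K₁) (j := s) (m' := F.m) (K' := K₂) (j' := n + s) (by omega)) (blockIter s z) =
      blockOfIter s (siteShift (F.sitesPerDir_eq (m := F.m) (K := K₁) (j := 0) (m' := F.m) (K' := K₂) (j' := n) (by omega)) z)
  | 0 => rfl
  | s + 1 => by
      rw [blockIter_succ, blockOfIter_succ, ← siteShift_blockIter_eq_blockOfIter hK z s]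
      exact siteShift_blockOf _ _ _

/-- ★★★ **THE T³ TRANSPORT OF READ′** (FILE 3′'s clause ⟹ (M-3)'s read set, `θ = 2`): if `ℓ′ : PBond (F.P (J+(t+1))) 0` has a witness `z` of its own level with
`blockIter (t+1) z ∈ {(bondShift B).src, (bondShift B).tgt}` and `|rel z ℓ′.src|_ν ≤ 2` (all `ν`), then — read inside the finest member `F.P K` at internal level `n` (`J + (t+1) + n = K`,
`m = n + (t+1)`) — the representative `embIter n (siteShift ℓ′.src)` belongs to `read n B := embIter n '' {Y : ∃ z₀ ∈ T^{(0)}, blockIter m z₀ ∈ ends B ∧ ∀ κ, |rel (blockIter n z₀) Y|_κ ≤ 2}` with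
`ends B = {(bondShift B).src, (bondShift B).tgt}` at level `m`. [cite: Balaban1987RG1, (0.1)-(0.4) pp.251-253; Balaban1985Averaging, Prop. 4 (128)-(135) pp.37-38] -/
theorem read'_transport {J t n m K : ℕ} (hK : J + (t + 1) + n = K) (hm : n + (t + 1) = m) (B : PBond (F.P J) 0) (ℓ' : PBond (F.P (J + (t + 1))) 0)
    (h : ∃ z : Site (F.P (J + (t + 1))) 0,
      (blockIter (t + 1) z = (bondShift (F.sitesPerDir_eq (m := F.m) (K := J) (j := 0) (m' := F.m) (K' := J + (t + 1)) (j' := t + 1) (by omega)) B).src ∨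
        blockIter (t + 1) z = (bondShift (F.sitesPerDir_eq (m := F.m) (K := J) (j := 0) (m' := F.m) (K' := J + (t + 1)) (j' := t + 1) (by omega)) B).tgt) ∧
      ∀ ν, (rel z ℓ'.src ν).natAbs ≤ 2) :
    embIter n (siteShift (F.sitesPerDir_eq (m := F.m) (K := J + (t + 1)) (j := 0) (m' := F.m) (K' := K) (j' := n) (by omega)) ℓ'.src) ∈
      (univ.filter (fun Y : Site (F.P K) n => ∃ z₀ : Site (F.P K) 0,
          blockIter m z₀ ∈ ({(bondShift (F.sitesPerDir_eq (m := F.m) (K := J) (j := 0) (m' := F.m) (K' := K) (j' := m) (by omega)) B).src,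
              (bondShift (F.sitesPerDir_eq (m := F.m) (K := J) (j := 0) (m' := F.m) (K' := K) (j' := m) (by omega)) B).tgt} : Finset (Site (F.P K) m)) ∧
            ∀ κ, (rel (blockIter n z₀) Y κ).natAbs ≤ 2)).image (embIter n) := by
  subst hK
  subst hm
  obtain ⟨z, hz, hrel⟩ := h
  have hn : n ≤ (F.P (J + (t + 1) + n)).m + (F.P (J + (t + 1) + n)).K := by
    show n ≤ F.m + (J + (t + 1) + n); omega
  have hnt : n + (t + 1) ≤ (F.P (J + (t + 1) + n)).m + (F.P (J + (t + 1) + n)).K := by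
    show n + (t + 1) ≤ F.m + (J + (t + 1) + n); omega
  refine mem_image_of_mem _ ?_
  rw [mem_filter]
  refine ⟨mem_univ _, embIter n (siteShift (F.sitesPerDir_eq (m := F.m) (K := J + (t + 1)) (j := 0) (m' := F.m) (K' := J + (t + 1) + n) (j' := n) (by omega)) z), ?_, ?_⟩
  · -- the gen-`m` ancestor of the witness is the transported endpoint
    have key : blockIter (n + (t + 1)) (embIter n (siteShift (F.sitesPerDir_eq (m := F.m) (K := J + (t + 1)) (j := 0) (m' := F.m) (K' := J + (t + 1) + n) (j' := n) (by omega)) z)) =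
        siteShift (F.sitesPerDir_eq (m := F.m) (K := J + (t + 1)) (j := t + 1) (m' := F.m) (K' := J + (t + 1) + n) (j' := n + (t + 1)) (by omega)) (blockIter (t + 1) z) :=
      (blockIter_add_embIter n (t + 1) hnt _).trans (siteShift_blockIter_eq_blockOfIter (K₁ := J + (t + 1)) rfl z (t + 1)).symm
    rcases hz with hz | hz
    · have e : blockIter (n + (t + 1)) (embIter n (siteShift (F.sitesPerDir_eq (m := F.m) (K := J + (t + 1)) (j := 0) (m' := F.m) (K' := J + (t + 1) + n) (j' := n) (by omega)) z)) =
          (bondShift (F.sitesPerDir_eq (m := F.m) (K := J) (j := 0) (m' := F.m) (K' := J + (t + 1) + n) (j' := n + (t + 1)) (by omega)) B).src :=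
        key.trans ((congrArg (siteShift _) hz).trans (by rw [bondShift_src, bondShift_src]; exact siteShift_siteShift _ _ _))
      exact mem_insert.mpr (Or.inl e)
    · have e : blockIter (n + (t + 1)) (embIter n (siteShift (F.sitesPerDir_eq (m := F.m) (K := J + (t + 1)) (j := 0) (m' := F.m) (K' := J + (t + 1) + n) (j' := n) (by omega)) z)) =
          (bondShift (F.sitesPerDir_eq (m := F.m) (K := J) (j := 0) (m' := F.m) (K' := J + (t + 1) + n) (j' := n + (t + 1)) (by omega)) B).tgt :=
        key.trans ((congrArg (siteShift _) hz).trans (by rw [bondShift_tgt, bondShift_tgt]; exact siteShift_siteShift _ _ _))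
      exact mem_insert.mpr (Or.inr (mem_singleton.mpr e))
  · intro κ
    rw [blockIter_embIter n hn]
    have e := congrArg Int.natAbs (congrFun (rel_siteShift
      (F.sitesPerDir_eq (m := F.m) (K := J + (t + 1)) (j := 0) (m' := F.m) (K' := J + (t + 1) + n) (j' := n) (by omega)) z ℓ'.src) κ)
    exact e.trans_le (hrel κ)


/-- ★★ **THE T³ TRANSPORT OF READ′, THICKENED** (px16 g23 19:00:59Z: the NC-row's ladder plaquettes of `ℓ′ ∈ READ′_t(B)` sit up to `D` sites from `ℓ′.src` at that level): every site `Y`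
with `|rel ℓ′.src Y|_κ ≤ D` is transported into (M-3)'s read set at thickness `θ := 2 + D` (triangle inequality ✓`natAbs_rel_le_add` with the READ′ witness, then as in
`read'_transport`) — ONE read-cell text for the knit and the NC-row holder. [cite: Balaban1987RG1, (0.1)-(0.4) pp.251-253; Balaban1985Averaging, Prop. 4 (128)-(135) pp.37-38] -/
theorem read'_transport_of_rel_le {J t n m K : ℕ} (hK : J + (t + 1) + n = K) (hm : n + (t + 1) = m) (B : PBond (F.P J) 0) (ℓ' : PBond (F.P (J + (t + 1))) 0)
    (h : ∃ z : Site (F.P (J + (t + 1))) 0,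
      (blockIter (t + 1) z = (bondShift (F.sitesPerDir_eq (m := F.m) (K := J) (j := 0) (m' := F.m) (K' := J + (t + 1)) (j' := t + 1) (by omega)) B).src ∨
        blockIter (t + 1) z = (bondShift (F.sitesPerDir_eq (m := F.m) (K := J) (j := 0) (m' := F.m) (K' := J + (t + 1)) (j' := t + 1) (by omega)) B).tgt) ∧
      ∀ ν, (rel z ℓ'.src ν).natAbs ≤ 2)
    {D : ℕ} (Y : Site (F.P (J + (t + 1))) 0) (hD : ∀ κ, (rel ℓ'.src Y κ).natAbs ≤ D) :
    embIter n (siteShift (F.sitesPerDir_eq (m := F.m) (K := J + (t + 1)) (j := 0) (m' := F.m) (K' := K) (j' := n) (by omega)) Y) ∈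
      (univ.filter (fun Y' : Site (F.P K) n => ∃ z₀ : Site (F.P K) 0,
          blockIter m z₀ ∈ ({(bondShift (F.sitesPerDir_eq (m := F.m) (K := J) (j := 0) (m' := F.m) (K' := K) (j' := m) (by omega)) B).src,
              (bondShift (F.sitesPerDir_eq (m := F.m) (K := J) (j := 0) (m' := F.m) (K' := K) (j' := m) (by omega)) B).tgt} : Finset (Site (F.P K) m)) ∧
            ∀ κ, (rel (blockIter n z₀) Y' κ).natAbs ≤ 2 + D)).image (embIter n) := by
  subst hK
  subst hm
  obtain ⟨z, hz, hrel⟩ := h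
  have hn : n ≤ (F.P (J + (t + 1) + n)).m + (F.P (J + (t + 1) + n)).K := by
    show n ≤ F.m + (J + (t + 1) + n); omega
  have hnt : n + (t + 1) ≤ (F.P (J + (t + 1) + n)).m + (F.P (J + (t + 1) + n)).K := by
    show n + (t + 1) ≤ F.m + (J + (t + 1) + n); omega
  refine mem_image_of_mem _ ?_
  rw [mem_filter]
  refine ⟨mem_univ _, embIter n (siteShift (F.sitesPerDir_eq (m := F.m) (K := J + (t + 1)) (j := 0) (m' := F.m) (K' := J + (t + 1) + n) (j' := n) (by omega)) z), ?_, ?_⟩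
  · have key : blockIter (n + (t + 1)) (embIter n (siteShift (F.sitesPerDir_eq (m := F.m) (K := J + (t + 1)) (j := 0) (m' := F.m) (K' := J + (t + 1) + n) (j' := n) (by omega)) z)) =
        siteShift (F.sitesPerDir_eq (m := F.m) (K := J + (t + 1)) (j := t + 1) (m' := F.m) (K' := J + (t + 1) + n) (j' := n + (t + 1)) (by omega)) (blockIter (t + 1) z) :=
      (blockIter_add_embIter n (t + 1) hnt _).trans (siteShift_blockIter_eq_blockOfIter (K₁ := J + (t + 1)) rfl z (t + 1)).symm
    rcases hz with hz | hz
    · exact mem_insert.mpr (Or.inl (key.trans ((congrArg (siteShift _) hz).trans (by rw [bondShift_src, bondShift_src]; exact siteShift_siteShift _ _ _))))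
    · exact mem_insert.mpr (Or.inr (mem_singleton.mpr
        (key.trans ((congrArg (siteShift _) hz).trans (by rw [bondShift_tgt, bondShift_tgt]; exact siteShift_siteShift _ _ _)))))
  · intro κ
    rw [blockIter_embIter n hn]
    have e := congrArg Int.natAbs (congrFun (rel_siteShift
      (F.sitesPerDir_eq (m := F.m) (K := J + (t + 1)) (j := 0) (m' := F.m) (K' := J + (t + 1) + n) (j' := n) (by omega)) z Y) κ)
    refine e.trans_le ?_
    exact (natAbs_rel_le_add z ℓ'.src Y κ).trans (add_le_add (hrel κ) (hD κ))

/-- ★ **THE ENDPOINT MULTIPLICITY `η = 2d = 6`** for (M-3)'s `card_filter_mem_top_le`: a site `e` of internal level `m` of `F.P K` is an endpoint (`src` or `tgt` after `bondShift`) of at most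
`6` coarsest bonds `B : PBond (F.P J) 0` (it is the source of `3` and the target of `3`). [folklore] -/
theorem card_filter_mem_ends_le {J m K : ℕ} (hK : J + m = K) (e : Site (F.P K) m) :
    (univ.filter (fun B : PBond (F.P J) 0 =>
        e ∈ ({(bondShift (F.sitesPerDir_eq (m := F.m) (K := J) (j := 0) (m' := F.m) (K' := K) (j' := m) (by omega)) B).src,
              (bondShift (F.sitesPerDir_eq (m := F.m) (K := J) (j := 0) (m' := F.m) (K' := K) (j' := m) (by omega)) B).tgt} : Finset (Site (F.P K) m)))).card ≤ 6 := by
  classical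
  subst hK
  set σ := bondShift (F := F) (F.sitesPerDir_eq (m := F.m) (K := J) (j := 0) (m' := F.m) (K' := J + m) (j' := m) (by omega)) with hσ
  -- the candidates: `σ⁻¹ ⟨e, μ⟩` and `σ⁻¹ ⟨e − e_μ, μ⟩`, `μ : Fin 3`
  have hsub : univ.filter (fun B : PBond (F.P J) 0 => e ∈ ({(σ B).src, (σ B).tgt} : Finset (Site (F.P (J + m)) m))) ⊆
      ((univ : Finset (Fin 3 × Bool)).image (fun p : Fin 3 × Bool =>
        σ.symm (if p.2 then (⟨e, p.1⟩ : PBond (F.P (J + m)) m) else ⟨e.unshift p.1, p.1⟩))) := by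
    intro B hB
    rw [mem_filter] at hB
    rw [mem_image]
    rcases mem_insert.mp hB.2 with h | h'
    · refine ⟨((σ B).dir, true), mem_univ _, ?_⟩
      simp only [if_true]
      subst h
      exact (Equiv.symm_apply_eq σ).mpr rfl
    · have h := mem_singleton.mp h'
      refine ⟨((σ B).dir, false), mem_univ _, ?_⟩
      simp only [Bool.false_eq_true, if_false]
      subst h
      refine (Equiv.symm_apply_eq σ).mpr ?_
      show (⟨((σ B).src.shift (σ B).dir).unshift (σ B).dir, (σ B).dir⟩ : PBond (F.PP F.m (J + m)) m) = σ B
      rw [Site.unshift_shift]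
  refine (card_le_card hsub).trans (card_image_le.trans ?_)
  simp

end Summit.QuantumFields.YangMills.Theorems.FluctuationComparisonRegPrIntLS2BetaTorusReadTransport
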